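import Literature.Geometry.GeometricMeasureTheory.Currents
import Mathlib.Analysis.Calculus.InverseFunctionTheorem.ContDiff
import Mathlib.Analysis.Normed.Module.FiniteDimension
import Mathlib.Analysis.Normed.Operator.Banach
import Mathlib.Topology.Algebra.Module.FiniteDimension
import HarnessLib

/-!
# `C¹` level sets are locally Lipschitz images of the kernel; countable rectifiability

Two elementary facts feeding the rectifiability of the regular part of an analytic set
(`Literature/Geometry/Kaehler/HolomorphicChainRectifiable*.lean`), for finite-dimensional real
normed spaces `V`, `F`:

* `exists_lipschitzOnWith_levelSet_subset_image` — **local Lipschitz parametrisation of a level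
  set by the kernel of the differential** (the implicit function theorem in the form of the
  inverse function theorem applied to `Φ = (π, g) : V → ker Dg(x) × F`, `π` a continuous linear
  projection onto the kernel): if `g` is `C¹` at `x` with `Dg(x)` onto, then near `x` the level
  set `{g = g x}` is contained in the image of a Lipschitz map defined on a subset of `ker Dg(x)`;
  `exists_lipschitzOnWith_levelSet_subset_image_euclidean` — the same with the parameter space
  `ℝᵐ = EuclideanSpace ℝ (Fin m)`, `m = dim ker Dg(x)`.
* `isCountablyRectifiable_of_locally_lipschitzOnWith_image` — a set which is locally contained
  in Lipschitz images of subsets of `ℝᵐ` is countably `m`-rectifiable in the sense of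
  `Currents.lean` (`IsCountablyRectifiable`: covered, up to an `𝓗^m`-null set — here up to
  nothing — by countably many GLOBALLY Lipschitz images of `ℝᵐ`), by Lindelöf and the Lipschitz
  extension theorem into finite-dimensional targets (`LipschitzOnWith.extend_finite_dimension`).

Everything is proved from Mathlib; no definitions, no named facts.

## References

* H. Federer, *Geometric Measure Theory*, Springer 1969, 3.1.19 (submanifolds of class 1 are
  locally Lipschitz graphs), 3.2.14 (countably rectifiable sets) [Federer1969].
-/

noncomputable section

open MeasureTheory Set Function Filter Metric Module Topology
open scoped ENNReal NNReal Topology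

namespace Literature.Geometry.GeometricMeasureTheory

variable {V : Type*} [NormedAddCommGroup V] [NormedSpace ℝ V] [FiniteDimensional ℝ V]
  {F : Type*} [NormedAddCommGroup F] [NormedSpace ℝ F] [FiniteDimensional ℝ F]

/-! ### Level sets of `C¹` submersions are locally Lipschitz images of the kernel -/

/-- **Local Lipschitz parametrisation of a `C¹` level set by the kernel of the differential.**
If `g : V → F` is `C¹` at `x` and `Dg(x)` is onto, then there are a neighbourhood `U` of `x`, a
subset `s` of `K₀ = ker Dg(x)` and a map `ψ : K₀ → V`, Lipschitz on `s`, with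
`{y ∈ U | g y = g x} ⊆ ψ(s)`. (Inverse function theorem for `Φ y = (π y, g y) ∈ K₀ × F`, `π` a
continuous projection onto `K₀`: `DΦ(x) = (π, Dg(x))` is invertible, and `y = Φ⁻¹(π y, g x)` on the
level set near `x`, with `Φ⁻¹` of class `C¹`, hence Lipschitz, near `Φ x`.)
[cite: Federer1969, 3.1.19] -/
theorem exists_lipschitzOnWith_levelSet_subset_image {g : V → F} {x : V}
    (hg : ContDiffAt ℝ 1 g x) (hsurj : Surjective (fderiv ℝ g x)) :
    ∃ U ∈ 𝓝 x, ∃ (K : ℝ≥0) (s : Set (LinearMap.ker (fderiv ℝ g x : V →ₗ[ℝ] F)))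
      (ψ : LinearMap.ker (fderiv ℝ g x : V →ₗ[ℝ] F) → V),
      LipschitzOnWith K ψ s ∧ {y ∈ U | g y = g x} ⊆ ψ '' s := by
  set g' : V →L[ℝ] F := fderiv ℝ g x with hg'
  set K₀ : Submodule ℝ V := LinearMap.ker (g' : V →ₗ[ℝ] F) with hK₀
  -- a continuous projection onto the kernel
  obtain ⟨π, hπ⟩ : K₀.ClosedComplemented := g'.ker_closedComplemented_of_finiteDimensional_range
  -- the map `Φ = (π, g)` and its invertible differential at `x`
  set Φ : V → K₀ × F := fun y => (π y, g y) with hΦ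
  set Φ' : V →L[ℝ] K₀ × F := π.prod g' with hΦ'
  have hgd : HasFDerivAt g g' x := (hg.differentiableAt one_ne_zero).hasFDerivAt
  have hΦd : HasFDerivAt Φ Φ' x := π.hasFDerivAt.prodMk hgd
  have hΦc : ContDiffAt ℝ 1 Φ x := π.contDiff.contDiffAt.prodMk hg
  have hker : LinearMap.ker (Φ' : V →ₗ[ℝ] K₀ × F) = ⊥ := by
    refine (Submodule.eq_bot_iff _).2 fun v hv => ?_
    rw [LinearMap.mem_ker] at hv
    have h1 : π v = 0 := congrArg Prod.fst hv
    have h2 : g' v = 0 := congrArg Prod.snd hv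
    have hvK : v ∈ K₀ := h2
    have h3 : π v = ⟨v, hvK⟩ := hπ ⟨v, hvK⟩
    rw [h3] at h1
    exact congrArg Subtype.val h1
  have hrange : LinearMap.range (Φ' : V →ₗ[ℝ] K₀ × F) = ⊤ := by
    refine LinearMap.range_eq_top.2 fun kw => ?_
    obtain ⟨k, w⟩ := kw
    obtain ⟨v₀, hv₀⟩ := hsurj w
    refine ⟨v₀ - (π v₀ : V) + (k : V), ?_⟩
    have hk0 : g' (k : V) = 0 := k.2
    have hp0 : g' ((π v₀ : K₀) : V) = 0 := (π v₀).2
    change (π (v₀ - (π v₀ : V) + (k : V)), g' (v₀ - (π v₀ : V) + (k : V))) = (k, w)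
    refine Prod.ext ?_ ?_
    · simp only [map_add, map_sub, hπ (π v₀), hπ k, sub_self, zero_add]
    · simp only [map_add, map_sub, hp0, hk0, sub_zero, add_zero]
      exact hv₀
  set e : V ≃L[ℝ] K₀ × F := ContinuousLinearEquiv.ofBijective Φ' hker hrange with he
  have hecoe : (e : V →L[ℝ] K₀ × F) = Φ' := ContinuousLinearEquiv.coe_ofBijective Φ' hker hrange
  have hΦd' : HasFDerivAt Φ (e : V →L[ℝ] K₀ × F) x := by rw [hecoe]; exact hΦd
  -- the local inverse, `C¹` hence Lipschitz near `Φ x`, and a left inverse near `x`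
  set ψ₀ : K₀ × F → V := hΦc.localInverse hΦd' one_ne_zero with hψ₀
  have hψ₀c : ContDiffAt ℝ 1 ψ₀ (Φ x) := hΦc.to_localInverse hΦd' one_ne_zero
  have hleft : ∀ᶠ y in 𝓝 x, ψ₀ (Φ y) = y :=
    (hΦc.hasStrictFDerivAt' hΦd' one_ne_zero).eventually_left_inverse
  obtain ⟨K, t, ht, hLip⟩ := hψ₀c.exists_lipschitzOnWith
  -- the neighbourhood, the parameter set and the parametrisation
  refine ⟨{y | ψ₀ (Φ y) = y} ∩ Φ ⁻¹' t, inter_mem hleft (hΦc.continuousAt.preimage_mem_nhds ht),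
    K * 1, {k | (k, g x) ∈ t}, fun k => ψ₀ (k, g x), ?_, ?_⟩
  · exact hLip.comp ((LipschitzWith.prodMk_right (g x)).lipschitzOnWith) fun k hk => hk
  · rintro y ⟨⟨hy1, hy2⟩, hgy⟩
    refine ⟨π y, ?_, ?_⟩
    · change (π y, g x) ∈ t
      rw [← hgy]
      exact hy2
    · change ψ₀ (π y, g x) = y
      rw [← hgy]
      exact hy1

/-- `exists_lipschitzOnWith_levelSet_subset_image` with parameter space `ℝᵐ`,
`m = dim ker Dg(x)`. [cite: Federer1969, 3.1.19] -/
theorem exists_lipschitzOnWith_levelSet_subset_image_euclidean {g : V → F} {x : V}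
    (hg : ContDiffAt ℝ 1 g x) (hsurj : Surjective (fderiv ℝ g x)) {m : ℕ}
    (hm : Module.finrank ℝ (LinearMap.ker (fderiv ℝ g x : V →ₗ[ℝ] F)) = m) :
    ∃ U ∈ 𝓝 x, ∃ (K : ℝ≥0) (s : Set (EuclideanSpace ℝ (Fin m)))
      (ψ : EuclideanSpace ℝ (Fin m) → V), LipschitzOnWith K ψ s ∧ {y ∈ U | g y = g x} ⊆ ψ '' s := by
  obtain ⟨U, hU, K, s, ψ, hψ, hsub⟩ := exists_lipschitzOnWith_levelSet_subset_image hg hsurj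
  set E : EuclideanSpace ℝ (Fin m) ≃L[ℝ] LinearMap.ker (fderiv ℝ g x : V →ₗ[ℝ] F) :=
    ContinuousLinearEquiv.ofFinrankEq (by rw [hm, finrank_euclideanSpace_fin]) with hE
  obtain ⟨L, hL⟩ : ∃ L, LipschitzWith L E := ⟨_, E.lipschitz⟩
  refine ⟨U, hU, K * L, E ⁻¹' s, ψ ∘ E,
    hψ.comp (hL.lipschitzOnWith (s := E ⁻¹' s)) (mapsTo_preimage _ _), hsub.trans ?_⟩
  rintro _ ⟨k, hk, rfl⟩
  exact ⟨E.symm k, by simpa using hk, by simp⟩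

/-! ### Locally Lipschitz-parametrised sets are countably rectifiable -/

variable [MeasurableSpace V] [BorelSpace V]

/-- **A set locally contained in Lipschitz images of subsets of `ℝᵐ` is countably
`m`-rectifiable**: choose such a parametrisation around each point, extract a countable subcover
(Lindelöf), and extend each Lipschitz map from its subset of `ℝᵐ` to all of `ℝᵐ`
(`LipschitzOnWith.extend_finite_dimension`); the set is then covered outright by countably many
Lipschitz images of `ℝᵐ`. [cite: Federer1969, 3.2.14] -/
theorem isCountablyRectifiable_of_locally_lipschitzOnWith_image {m : ℕ} {W : Set V}
    (h : ∀ x ∈ W, ∃ U ∈ 𝓝 x, ∃ (K : ℝ≥0) (s : Set (EuclideanSpace ℝ (Fin m)))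
      (ψ : EuclideanSpace ℝ (Fin m) → V), LipschitzOnWith K ψ s ∧ W ∩ U ⊆ ψ '' s) :
    IsCountablyRectifiable m W := by
  classical
  choose! U hU K s ψ hψ hcov using h
  -- countable subcover
  obtain ⟨t, htW, htc, hWt⟩ := TopologicalSpace.countable_cover_nhdsWithin
    (fun x hx => mem_nhdsWithin_of_mem_nhds (hU x hx))
  -- global Lipschitz extensions
  have hext : ∀ x ∈ t, ∃ G : EuclideanSpace ℝ (Fin m) → V, (∃ L, LipschitzWith L G) ∧
      W ∩ U x ⊆ range G := by
    intro x hx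
    obtain ⟨G, hG, hEq⟩ := (hψ x (htW hx)).extend_finite_dimension
    refine ⟨G, ⟨_, hG⟩, (hcov x (htW hx)).trans ?_⟩
    rintro _ ⟨k, hk, rfl⟩
    exact ⟨k, (hEq hk).symm⟩
  choose! G hGL hGcov using hext
  rcases t.eq_empty_or_nonempty with ht | ht
  · -- no points: `W = ∅`
    have hW : W = ∅ := by
      refine eq_empty_iff_forall_notMem.2 fun y hy => ?_
      have := hWt hy
      rw [ht] at this
      simp at this
    rw [hW]
    exact isCountablyRectifiable_empty
  · obtain ⟨c, hc⟩ := htc.exists_eq_range ht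
    refine ⟨fun i => G (c i), fun i => hGL (c i) (hc ▸ mem_range_self i), ?_⟩
    have hsub : W ⊆ ⋃ i, range (G (c i)) := by
      intro y hy
      obtain ⟨x, hx, hyx⟩ := mem_iUnion₂.1 (hWt hy)
      have hx' : x ∈ range c := hc ▸ hx
      obtain ⟨i, rfl⟩ := hx'
      exact mem_iUnion.2 ⟨i, hGcov (c i) hx ⟨hy, hyx⟩⟩
    have : W \ ⋃ i, range (G (c i)) = ∅ := sdiff_eq_empty.2 hsub
    rw [this, measure_empty]

end Literature.Geometry.GeometricMeasureTheory
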